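import Summits.HodgeConjecture.HodgeConjecture.Theorems.RigidUnwindingKummerEndgameFiniteEtaleTrivialisation
import Literature.AlgebraicGeometry.HodgeTheory.DirectImageBaseChangeContinuous
import Literature.AlgebraicGeometry.HodgeTheory.CorrespondenceCupProductIdentities

/-!
# Route RigidUnwinding — crux `KummerEndgame` (stmt-HodgeConjecture-14766), line `birth`: transport of the frame along fibre isomorphisms and base change

Infrastructure for the registered stub D `stub_frameDescent` of `Cruxes/KummerEndgame/Lines/birth.lean`
(base change of the whole frame of the crux along the trivialising finite étale cover, and descent
of the algebraic operator). The frame of `KummerEndgame` / `TrivialisedEndgame` consists of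

* the predicate `Alg a q b t T` — "the operator `T : Hᵃ(Y_t) → Hᵇ(Y_t)` is induced by an algebraic
  correspondence": `∃ ζ ∈ algebraicClasses (Y_t × Y_t) q, ∃ ω ≠ 0 ∈ H^{2d}(Y_t)` with
  `(pr₁^* α ∪ ζ) ∪ pr₂^* β = pr₁^* ω ∪ pr₂^* (T α ∪ β)` for all `α`, `β` (inlined in the skeleton, so
  spelled out verbatim below);
* the predicate `Flat a b T` — `T` carries flat continuations to flat continuations.

This file proves, with no Hodge theory and no named fact:

* `alg_transport_of_iso` — `Alg` for `T` on `Z` gives `Alg` for the conjugate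
  `φ^* ∘ T ∘ (φ⁻¹)^*` on `Z'` along an isomorphism `φ : Z' ≅ Z` (`ζ' = (φ × φ)^* ζ`, `ω' = φ^* ω`;
  pull-back is a ring homomorphism natural in the projections, algebraic classes transport along
  isomorphisms — `mem_algebraicClasses_map_iff_of_iso`).
* `transportFun_apply_of_flat'` — a flat family of operators `Hᵃ → Hᵇ` commutes with transport.
* `flat_familyPullback_of_flat` — **`Flat` passes to the base change**: for `g : U' ⟶ U` and the
  fibre isomorphisms `ε_{t'} : (𝒴 ×_U U')_{t'} ≅ Y_{g t'}`, the conjugated family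
  `ε^* ∘ T_{g t'} ∘ (ε⁻¹)^*` is flat on `𝒴 ×_U U' ⟶ U'` when `T` is flat on `𝒴 ⟶ U` (both direct images
  local systems): transport commutes with base change
  (`FiberClass.baseChange_transportFun_of_isCohomologicallyLocallyTrivialOn`) and continuations are
  transports (`isContinuationAlong_iff_transportFun_eq`).

`HC_CM` plays no role here; nothing here proves a case of the Hodge conjecture.

References: [VoisinHodgeI2002] C. Voisin, Hodge Theory and Complex Algebraic Geometry I, §9.2.1,
§11.3.3; [VoisinHodgeII2003] §3.1.2; [FultonYoungTableaux1997] App. B; [HatcherAT2002] §3.2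
Prop. 3.10, §1.3 Prop. 1.34.
-/

noncomputable section

-- mandated namespace of this single-conjunct summit (as in the sibling `Theorems/*` files)
set_option linter.dupNamespace false

open CategoryTheory MonoidalCategory CartesianMonoidalCategory AlgebraicGeometry TopologicalSpace
open Literature.AlgebraicGeometry.Motives Literature.AlgebraicGeometry.HodgeTheory
open Literature.AlgebraicTopology.SingularHomology

namespace Summit.HodgeConjecture.HodgeConjecture.Theorems

/-! ### `Alg` along an isomorphism of fibres -/

section Alg

variable {Z Z' : SchemeOver ℂ} (φ : Z' ≅ Z)

/-- `pr₁^* φ^* = (φ × φ)^* pr₁^*` on classes. [cite: FultonYoungTableaux1997, Appendix B §B.1 (1)] -/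
theorem map_fst_map_iso_hom (i : ℕ) (c : complexBetti Z i) :
    complexBetti.map (fst Z' Z') i (complexBetti.map φ.hom i c) =
      complexBetti.map (φ.hom ⊗ₘ φ.hom) i (complexBetti.map (fst Z Z) i c) := by
  rw [← CategoryTheory.comp_apply, ← complexBetti.map_comp, ← CategoryTheory.comp_apply,
    ← complexBetti.map_comp, tensorHom_fst]

/-- `pr₂^* φ^* = (φ × φ)^* pr₂^*` on classes. [cite: FultonYoungTableaux1997, Appendix B §B.1 (1)] -/
theorem map_snd_map_iso_hom (i : ℕ) (c : complexBetti Z i) :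
    complexBetti.map (snd Z' Z') i (complexBetti.map φ.hom i c) =
      complexBetti.map (φ.hom ⊗ₘ φ.hom) i (complexBetti.map (snd Z Z) i c) := by
  rw [← CategoryTheory.comp_apply, ← complexBetti.map_comp, ← CategoryTheory.comp_apply,
    ← complexBetti.map_comp, tensorHom_snd]

/-- **`Alg` transports along an isomorphism of fibres.** If `T : Hᵃ(Z) → Hᵇ(Z)` is induced by an
algebraic correspondence `ζ` on `Z × Z` with fundamental class `ω` (the inlined `Alg a q b` of the
crux `KummerEndgame`), then the conjugate `φ^* ∘ T ∘ (φ⁻¹)^* : Hᵃ(Z') → Hᵇ(Z')` along `φ : Z' ≅ Z` is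
induced by `(φ × φ)^* ζ` with fundamental class `φ^* ω`. [cite: VoisinHodgeI2002, §11.3.3]
[cite: HatcherAT2002, §3.2 Prop. 3.10] -/
theorem alg_transport_of_iso {d a q b : ℕ} (T : complexBetti Z a →ₗ[ℂ] complexBetti Z b)
    (h : ∃ ζ ∈ algebraicClasses (Z ⊗ Z) q, ∃ ω : complexBetti Z (2 * d), ω ≠ 0 ∧
      ∀ (b' : ℕ) (hb : b + b' = 2 * d) (hq : (a + 2 * q) + b' = 4 * d) (α : complexBetti Z a)
        (β : complexBetti Z b'),
        cupProduct hq (cupProduct (show a + 2 * q = a + 2 * q from rfl)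
          (complexBetti.map (fst Z Z) a α) ζ) (complexBetti.map (snd Z Z) b' β) =
        cupProduct (show 2 * d + 2 * d = 4 * d by omega) (complexBetti.map (fst Z Z) (2 * d) ω)
          (complexBetti.map (snd Z Z) (2 * d) (cupProduct hb (T α) β))) :
    ∃ ζ' ∈ algebraicClasses (Z' ⊗ Z') q, ∃ ω' : complexBetti Z' (2 * d), ω' ≠ 0 ∧
      ∀ (b' : ℕ) (hb : b + b' = 2 * d) (hq : (a + 2 * q) + b' = 4 * d) (α : complexBetti Z' a)
        (β : complexBetti Z' b'),
        cupProduct hq (cupProduct (show a + 2 * q = a + 2 * q from rfl)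
          (complexBetti.map (fst Z' Z') a α) ζ') (complexBetti.map (snd Z' Z') b' β) =
        cupProduct (show 2 * d + 2 * d = 4 * d by omega) (complexBetti.map (fst Z' Z') (2 * d) ω')
          (complexBetti.map (snd Z' Z') (2 * d) (cupProduct hb
            (((complexBetti.map φ.hom b).hom ∘ₗ T ∘ₗ (complexBetti.map φ.inv a).hom) α) β)) := by
  obtain ⟨ζ, hζ, ω, hω, hid⟩ := h
  refine ⟨complexBetti.map (φ.hom ⊗ₘ φ.hom) (2 * q) ζ, ?_, complexBetti.map φ.hom (2 * d) ω, ?_, ?_⟩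
  · exact (mem_algebraicClasses_map_iff_of_iso (φ ⊗ᵢ φ)).2 hζ
  · intro h0
    apply hω
    have h1 := congrArg (complexBetti.map φ.inv (2 * d)) h0
    rwa [φ.complexBetti_map_inv_map_hom, map_zero] at h1
  · intro b' hb hq α β
    -- write `α = φ^* α₀`, `β = φ^* β₀`
    set α₀ := complexBetti.map φ.inv a α with hα₀
    set β₀ := complexBetti.map φ.inv b' β with hβ₀
    have hα : α = complexBetti.map φ.hom a α₀ := (φ.complexBetti_map_hom_map_inv a α).symm
    have hβ : β = complexBetti.map φ.hom b' β₀ := (φ.complexBetti_map_hom_map_inv b' β).symm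
    have hT : ((complexBetti.map φ.hom b).hom ∘ₗ T ∘ₗ (complexBetti.map φ.inv a).hom) α =
        complexBetti.map φ.hom b (T α₀) := rfl
    rw [hT, hα, hβ, map_fst_map_iso_hom, map_snd_map_iso_hom, map_fst_map_iso_hom,
      ← complexBetti.map_cupProduct, ← complexBetti.map_cupProduct, ← complexBetti.map_cupProduct,
      hid b' hb hq α₀ β₀, complexBetti.map_cupProduct, map_snd_map_iso_hom,
      complexBetti.map_cupProduct (snd Z Z)]

end Alg

/-! ### `Flat` along a base change -/

section Flat

variable {𝒴 U U' : SchemeOver ℂ} (f : 𝒴 ⟶ U) (g : U' ⟶ U) {a b : ℕ}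
  (hU : IsCohomologicallyLocallyTrivialOn f (Set.univ : Set (ComplexPoints U)))
  (hU' : IsCohomologicallyLocallyTrivialOn (familyPullback.snd f g) (Set.univ : Set (ComplexPoints U')))
  (T : ∀ t : ComplexPoints U, complexBetti (fiberOver f t) a →ₗ[ℂ] complexBetti (fiberOver f t) b)

/-- **A flat family of operators `Hᵃ → Hᵇ` commutes with transport**: `γ_* (T_s α) = T_t (γ_* α)`
(degree-changing form of `transportFun_apply_of_flat`). [cite: VoisinHodgeI2002, §9.2.1] -/
theorem transportFun_apply_of_flat'
    (hT : ∀ (s t : ComplexPoints U) (γ : Path s t) (α : complexBetti (fiberOver f s) a)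
      (β : complexBetti (fiberOver f t) a),
      IsContinuationAlong γ α β → IsContinuationAlong γ (T s α) (T t β))
    {s t : (Set.univ : Set (ComplexPoints U))} (γ : Path s t) (α : complexBetti (fiberOver f s.1) a) :
    transportFun f b hU ⟦γ⟧ (T s.1 α) = T t.1 (transportFun f a hU ⟦γ⟧ α) := by
  have h := (isContinuationAlong_iff_transportFun_eq f b hU _ _ _).1
    (hT _ _ _ _ _ (isContinuationAlong_transportFun f a hU γ α))
  rwa [path_map_val_map_mk] at h

/-- Transfer of a class on a fibre of the base change: `ε⁻¹^* (ε^* c) = c` packaged as the fibre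
class identity `(g s', c) = transfer (s', ε^* c)`. [folklore] -/
theorem mk_eq_baseChange_mk_map_hom (k : ℕ) (s' : ComplexPoints U')
    (c : complexBetti (fiberOver f (AlgPoints.map g s')) k) :
    (⟨AlgPoints.map g s', c⟩ : FiberClass f k) =
      FiberClass.baseChange f g k ⟨s', complexBetti.map (fiberOverFamilyPullbackIso f g s').hom k c⟩ := by
  change (⟨AlgPoints.map g s', c⟩ : FiberClass f k) =
    ⟨AlgPoints.map g s', complexBetti.map (fiberOverFamilyPullbackIso f g s').inv k
      (complexBetti.map (fiberOverFamilyPullbackIso f g s').hom k c)⟩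
  rw [(fiberOverFamilyPullbackIso f g s').complexBetti_map_inv_map_hom]

/-- **Transport upstairs is the conjugate of transport downstairs**: for a path `γ'` of `U'(ℂ)` and a
class `c` on `Y_{g s'}`, `γ'_* (ε_{s'}^* c) = ε_{t'}^* ((g ∘ γ')_* c)`.
[cite: VoisinHodgeII2003, §3.1.2] [cite: HatcherAT2002, §1.3 Prop. 1.34] -/
theorem transportFun_familyPullback_map_hom (k : ℕ) {s' t' : (Set.univ : Set (ComplexPoints U'))}
    (γ' : Path s' t') (c : complexBetti (fiberOver f (AlgPoints.map g s'.1)) k) :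
    transportFun (familyPullback.snd f g) k hU' ⟦γ'⟧
        (complexBetti.map (fiberOverFamilyPullbackIso f g s'.1).hom k c) =
      complexBetti.map (fiberOverFamilyPullbackIso f g t'.1).hom k
        (transportFun f k hU (s := ⟨AlgPoints.map g s'.1, Set.mem_univ _⟩)
          (t := ⟨AlgPoints.map g t'.1, Set.mem_univ _⟩)
          ⟦γ'.map ((((AlgPoints.continuous_map g).comp continuous_subtype_val)).subtype_mk
            fun _ ↦ Set.mem_univ _)⟧ c) := by
  have key := FiberClass.baseChange_transportFun_of_isCohomologicallyLocallyTrivialOn f g hU hU' k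
    (s := ⟨AlgPoints.map g s'.1, Set.mem_univ _⟩) (t := ⟨AlgPoints.map g t'.1, Set.mem_univ _⟩)
    (γ'.map ((((AlgPoints.continuous_map g).comp continuous_subtype_val)).subtype_mk
      fun _ ↦ Set.mem_univ _)) γ' (fun _ ↦ rfl)
    (complexBetti.map (fiberOverFamilyPullbackIso f g s'.1).hom k c)
    (mk_eq_baseChange_mk_map_hom f g k s'.1 c)
  -- compare with the transfer of `(t', ε^* ε⁻¹^* γ'_* ε^* c)`
  set y := transportFun (familyPullback.snd f g) k hU' ⟦γ'⟧
    (complexBetti.map (fiberOverFamilyPullbackIso f g s'.1).hom k c) with hy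
  have hy' : y = complexBetti.map (fiberOverFamilyPullbackIso f g t'.1).hom k
      (complexBetti.map (fiberOverFamilyPullbackIso f g t'.1).inv k y) :=
    ((fiberOverFamilyPullbackIso f g t'.1).complexBetti_map_hom_map_inv k y).symm
  rw [hy', ← mk_eq_baseChange_mk_map_hom f g k t'.1] at key
  rw [hy', ← (FiberClass.mk_eq_mk_iff _ _).1 key]

include hU hU' in
/-- **`Flat` passes to the base change.** If the family `T_t : Hᵃ(Y_t) → Hᵇ(Y_t)` carries flat
continuations to flat continuations on `𝒴 ⟶ U`, so does the conjugated family
`ε_{t'}^* ∘ T_{g t'} ∘ (ε_{t'}⁻¹)^*` on the base change `𝒴 ×_U U' ⟶ U'` (`Rᵃ`, `Rᵇ` local systems on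
both bases). [cite: VoisinHodgeII2003, §3.1.2] [cite: VoisinHodgeI2002, §9.2.1] -/
theorem flat_familyPullback_of_flat
    (hT : ∀ (s t : ComplexPoints U) (γ : Path s t) (α : complexBetti (fiberOver f s) a)
      (β : complexBetti (fiberOver f t) a),
      IsContinuationAlong γ α β → IsContinuationAlong γ (T s α) (T t β))
    (s' t' : ComplexPoints U') (γ' : Path s' t')
    (α' : complexBetti (fiberOver (familyPullback.snd f g) s') a)
    (β' : complexBetti (fiberOver (familyPullback.snd f g) t') a)
    (h : IsContinuationAlong γ' α' β') :
    IsContinuationAlong γ'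
      (((complexBetti.map (fiberOverFamilyPullbackIso f g s').hom b).hom ∘ₗ T (AlgPoints.map g s') ∘ₗ
        (complexBetti.map (fiberOverFamilyPullbackIso f g s').inv a).hom) α')
      (((complexBetti.map (fiberOverFamilyPullbackIso f g t').hom b).hom ∘ₗ T (AlgPoints.map g t') ∘ₗ
        (complexBetti.map (fiberOverFamilyPullbackIso f g t').inv a).hom) β') := by
  -- notation
  set εs := fiberOverFamilyPullbackIso f g s' with hεs
  set εt := fiberOverFamilyPullbackIso f g t' with hεt
  set γu : Path (⟨s', Set.mem_univ s'⟩ : (Set.univ : Set (ComplexPoints U'))) ⟨t', Set.mem_univ t'⟩ :=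
    γ'.map (continuous_id.subtype_mk fun x ↦ Set.mem_univ x) with hγu
  -- `α' = ε^* α₀`, and `β' = γ'_* α' = ε^* ((g γ')_* α₀)`
  set α₀ := complexBetti.map εs.inv a α' with hα₀
  have hα' : α' = complexBetti.map εs.hom a α₀ := (εs.complexBetti_map_hom_map_inv a α').symm
  have hβ' : β' = transportFun (familyPullback.snd f g) a hU' ⟦γu⟧ α' :=
    ((isContinuationAlong_iff_transportFun_eq _ a hU' γ' α' β').1 h).symm
  -- the claim in transport form
  rw [isContinuationAlong_iff_transportFun_eq _ b hU']
  change transportFun (familyPullback.snd f g) b hU' ⟦γu⟧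
      (complexBetti.map εs.hom b (T _ (complexBetti.map εs.inv a α'))) =
    complexBetti.map εt.hom b (T _ (complexBetti.map εt.inv a β'))
  rw [← hα₀, transportFun_familyPullback_map_hom f g hU hU' b γu,
    transportFun_apply_of_flat' f hU T hT, hβ', hα', transportFun_familyPullback_map_hom f g hU hU' a γu,
    εt.complexBetti_map_inv_map_hom]

end Flat

end Summit.HodgeConjecture.HodgeConjecture.Theorems

end
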